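import Summits.SmoothPoincare4.SmoothPoincare4.Theses.EntropyRung
import HarnessLib

/-!
# Crux `EntropyRung.ConicalGap` (stmt-SmoothPoincare4-16589) — the strategist's typed split K | C | U
(glue for `ledger route edit --split ConicalGap`)

Recorded by the crux-strategist seat (WALL-BREAKER on the exhausted chain: two ideation rounds, triage panels r1-1/2 and
r2-1/2/3, the only checked line `Sketch` dead at its apex `stub_coreBudget ⇔ crux`, p128084; census
`Cruxes/ConicalGap/STRATEGY-CENSUS.md`).  The crux is the density gap `∫ e^{-f} dV ≤ 32π²√π e^{-3/2}` (`Θ ≤ Θ(S³×ℝ) = .791`)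
for complete connected non-compact non-flat normalised 4-d gradient shrinking Ricci solitons whose scalar curvature decays
at infinity (the asymptotically conical class).  Every dead line and rejected idea of the chain died at the same place:
any sufficient condition for the bound must contain an EXPLICIT rigidity of the Gaussian soliton among AC 4-d shrinkers
(TRIAGE-r2-3, Lines/Sketch-dead.md §3), an input of a different KIND from the identities / comparison geometry / Picone
positivity / Gauss–Bonnet bookkeeping the chain produced.  The two inputs of a different kind that ARE available today are
(i) the Kähler classification ON THIS VERY CLASS (Conlon–Deruelle–Sun, Geom. Topol. 28 (2024) = arXiv:1904.00147, Thm E(3) [arXiv: Thm 5(3), "Classification of shrinkers"]: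
a complete shrinking gradient Kähler–Ricci soliton surface whose scalar curvature tends to zero at infinity is, up to
pullback by `GL(2,ℂ)`, the flat Gaussian on `ℂ²` or FIK on `Bl₀ℂ² = O(−1)`; umbrella without any curvature hypothesis:
Li–Wang arXiv:2301.09784 = Acta Math. 2026, Thm 1.1), with `Θ(FIK) = e^{√2−2}(1+√2)/2 = .672 < .791` (CHI 2004 §4;
`fikDensity_lt_thetaCyl` in `Cruxes/ConicalGap/Disproof.lean`), and (ii) TOPOLOGY: the rung `RecognitionOfShrinkerGaps` instantiates the gap only at shrinkers
that occur as blow-up limits of a Ricci flow on a closed `M ≃ₕ S⁴`, whose sublevel sets `{f < t}` therefore embed smoothly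
in a smooth homotopy 4-sphere ("confinement"; card g17 `confined-psc-link-census`, lead c2 §2, parent Disproof 10(vi)) —
which the one known non-flat AC shrinker violates (FIK lives on `O(−1)`, whose zero section is a smoothly embedded 2-sphere
of self-intersection `−1`, impossible inside a homology 4-sphere).

THE SPLIT is the partition of the crux class by these two predicates (so the conjunction of the children is EQUIVALENT to
the crux — nothing is strengthened, nothing smuggled; `conicalGap_of_subs` is two `by_cases`, and each child follows back
from the crux by forgetting its extra hypothesis, `*_of_conicalGap` below):

* `KaehlerConicalGap` (K — KNOWN IN PRINT, formal debt XL): the crux for shrinkers admitting a `g`-orthogonal almost complex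
  structure `J` (`J² = −1`) that is PARALLEL for the Levi-Civita connection (`∇(JY) = J∇Y` on differentiable fields; a
  parallel orthogonal `J` is integrable, so `(g, J)` is Kähler).  In print: CDS Thm E(3) (Kähler + `R → 0` ⇒ flat or FIK) +
  `Θ(FIK) = .672` (CHI 2004; arithmetic `fikDensity_lt_thetaCyl`).  A NAMED-FACT-grade item (CDS Thm E(3) to be vendored as a
  Literature fact over this inline predicate; FIK's density in the tree's vocabulary needs the U(2) Calabi-ansatz model).
* `ConfinedNonKaehlerConicalGap` (C — THE SUMMIT-RELEVANT OPEN CORE): the crux for NON-Kähler shrinkers whose every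
  sublevel set `{f < t}` admits an open smooth embedding (smooth map, open image, smooth left inverse on the image) into
  ONE smooth closed 4-manifold homotopy equivalent to `S⁴`.  This is exactly the instance the deciding theorem `closes`
  consumes (the blow-up limit at the first singular time of a flow on `M ≃ₕ S⁴` is a smooth pointed limit, so its compact
  sublevel sets embed back into `M`).  No member of this class is known (the confined Kähler AC class is EMPTY by CDS:
  `ℂ²` is flat and FIK is unconfined); the new hypothesis is of a new kind —
  `M` is then spin with identically zero intersection pairing on `H₂`, every cone link (a closed PSC 3-manifold,
  `R_link > 6`) embeds in a homotopy 4-sphere (Hantzsche / linking-form obstructions: no lens-space or `S³/Q₈` summand),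
  and `π₁(M)` is finite (Wylie 2008).
* `UnconfinedNonKaehlerConicalGap` (U — NOT NEEDED BY THE SUMMIT): the crux for non-Kähler shrinkers that are NOT
  confined.  It is where every future counterexample hunter should look (triaxial `SU(2)` bolts on `O(−1), O(−2), O(−4)`,
  cohomogeneity-two non-Kähler families) and it can be DROPPED from the cone of `closes` by re-gluing the rung along
  confinement (the g17 Sketch proved `ConfinedNoncompactGapReduction` verbatim from the landed reduction; recommendation
  to the tenure planner in the census).  A refutation of U refutes the crux AS FILED but not the thesis.

HONESTY.  The split does not make C easier by itself: C is an open problem with no example and no theorem; what it does is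
(1) take the Kähler class — the entire KNOWN content of the crux — out of the open item, (2) put the one available
hypothesis of a new kind on the table where ideation and disproof can use it, and (3) mark the gratuitous generality U
as such.  No new definitions (the two predicates are inlined so that the children are one-line Props over existing
declarations); no named fact is used; axioms `propext`, `Classical.choice`, `Quot.sound` (the case split is classical).
-/

noncomputable section

set_option linter.dupNamespace false

open scoped Manifold ContDiff ENNReal NNReal Topology
open MeasureTheory Set Filter
open Literature.Geometry.Lorentzian Literature.Geometry.Riemannian

namespace Summit.SmoothPoincare4.SmoothPoincare4.Theorems

open Summit.SmoothPoincare4.SmoothPoincare4.Theses.EntropyRung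

/-- **Typed split of `ConicalGap` (K | C | U).**  Hypotheses, in order, verbatim the `statement`s filed with
`route edit --split ConicalGap`: (K) `KaehlerConicalGap` — the density gap for complete connected non-compact non-flat
normalised AC 4-d shrinkers carrying a parallel `g`-orthogonal almost complex structure (known in print: Conlon–Deruelle–Sun
2024 Thm E(3) [arXiv: Thm 5(3)] — Kähler with `R → 0` ⇒ flat or FIK — and `Θ(FIK) = .672`); (C) `ConfinedNonKaehlerConicalGap` — the gap for the
non-Kähler ones whose sublevel sets `{f < t}` embed smoothly in one smooth homotopy 4-sphere (the instance the rung
consumes; open, no example known); (U) `UnconfinedNonKaehlerConicalGap` — the gap for the non-Kähler unconfined ones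
(open; not needed by `closes` after a confinement re-glue).  Conclusion: the route decl `EntropyRung.ConicalGap`.
Proof: excluded middle on the two predicates. [folklore] -/
theorem conicalGap_of_subs :
    (∀ (M : Type) [TopologicalSpace M] [T2Space M] [SecondCountableTopology M] [ChartedSpace (EuclideanSpace ℝ (Fin
      4)) M] [IsManifold (𝓡 4) ∞ M] [ConnectedSpace M] [NoncompactSpace M] [T3Space M] [MeasurableSpace M]
      [BorelSpace M] (g : Literature.Geometry.Lorentzian.PseudoRiemannianMetric (𝓡 4) ∞ (EuclideanSpace ℝ (Fin 4))
      (TangentSpace (𝓡 4) : M → Type _)) [g.HasLeviCivita] (f : M → ℝ) (hg : g.IsRiemannian), (∀ (x : M) (r :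
      NNReal), IsCompact {y : M | g.edist hg x y ≤ r}) → ContMDiff (𝓡 4) 𝓘(ℝ, ℝ) ∞ f → (∀ (x : M) (X Y :
      TangentSpace (𝓡 4) x), g.ricci x X Y + g.hessian f x X Y = (1 / 2 : ℝ) * g.val x X Y) → (∀ x : M,
      g.scalarCurvature x + g.gradSq f x = f x) → (∃ x : M, g.scalarCurvature x ≠ 0) → (∀ ε : ℝ, 0 < ε → ∃ K : Set
      M, IsCompact K ∧ ∀ x, x ∉ K → g.scalarCurvature x < ε) → (∃ J : (∀ x : M, TangentSpace (𝓡 4) x →L[ℝ]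
      TangentSpace (𝓡 4) x), (∀ (x : M) (v : TangentSpace (𝓡 4) x), J x (J x v) = -v) ∧ (∀ (x : M) (v w :
      TangentSpace (𝓡 4) x), g.val x (J x v) (J x w) = g.val x v w) ∧ (∀ Y : (∀ x : M, TangentSpace (𝓡 4) x), (∀ x :
      M, MDifferentiableAt (𝓡 4) ((𝓡 4).prod 𝓘(ℝ, EuclideanSpace ℝ (Fin 4))) (fun y : M ↦ Bundle.TotalSpace.mk'
      (EuclideanSpace ℝ (Fin 4)) y (Y y)) x) → (∀ x : M, MDifferentiableAt (𝓡 4) ((𝓡 4).prod 𝓘(ℝ, EuclideanSpace ℝ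
      (Fin 4))) (fun y : M ↦ Bundle.TotalSpace.mk' (EuclideanSpace ℝ (Fin 4)) y (J y (Y y))) x) ∧ ∀ (x : M) (v :
      TangentSpace (𝓡 4) x), g.leviCivita (fun y : M ↦ J y (Y y)) x v = J x (g.leviCivita Y x v))) → ∫⁻ x,
      ENNReal.ofReal (Real.exp (-f x)) ∂(Literature.Geometry.Lorentzian.riemannianMeasure
      (g.toContMDiffRiemannianMetric hg)) ≤ ENNReal.ofReal (32 * Real.pi ^ 2 * Real.sqrt Real.pi * Real.exp (-(3 :
      ℝ) / 2))) →
    (∀ (M : Type) [TopologicalSpace M] [T2Space M] [SecondCountableTopology M] [ChartedSpace (EuclideanSpace ℝ (Fin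
      4)) M] [IsManifold (𝓡 4) ∞ M] [ConnectedSpace M] [NoncompactSpace M] [T3Space M] [MeasurableSpace M]
      [BorelSpace M] (g : Literature.Geometry.Lorentzian.PseudoRiemannianMetric (𝓡 4) ∞ (EuclideanSpace ℝ (Fin 4))
      (TangentSpace (𝓡 4) : M → Type _)) [g.HasLeviCivita] (f : M → ℝ) (hg : g.IsRiemannian), (∀ (x : M) (r :
      NNReal), IsCompact {y : M | g.edist hg x y ≤ r}) → ContMDiff (𝓡 4) 𝓘(ℝ, ℝ) ∞ f → (∀ (x : M) (X Y :
      TangentSpace (𝓡 4) x), g.ricci x X Y + g.hessian f x X Y = (1 / 2 : ℝ) * g.val x X Y) → (∀ x : M,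
      g.scalarCurvature x + g.gradSq f x = f x) → (∃ x : M, g.scalarCurvature x ≠ 0) → (∀ ε : ℝ, 0 < ε → ∃ K : Set
      M, IsCompact K ∧ ∀ x, x ∉ K → g.scalarCurvature x < ε) → ¬ (∃ J : (∀ x : M, TangentSpace (𝓡 4) x →L[ℝ]
      TangentSpace (𝓡 4) x), (∀ (x : M) (v : TangentSpace (𝓡 4) x), J x (J x v) = -v) ∧ (∀ (x : M) (v w :
      TangentSpace (𝓡 4) x), g.val x (J x v) (J x w) = g.val x v w) ∧ (∀ Y : (∀ x : M, TangentSpace (𝓡 4) x), (∀ x :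
      M, MDifferentiableAt (𝓡 4) ((𝓡 4).prod 𝓘(ℝ, EuclideanSpace ℝ (Fin 4))) (fun y : M ↦ Bundle.TotalSpace.mk'
      (EuclideanSpace ℝ (Fin 4)) y (Y y)) x) → (∀ x : M, MDifferentiableAt (𝓡 4) ((𝓡 4).prod 𝓘(ℝ, EuclideanSpace ℝ
      (Fin 4))) (fun y : M ↦ Bundle.TotalSpace.mk' (EuclideanSpace ℝ (Fin 4)) y (J y (Y y))) x) ∧ ∀ (x : M) (v :
      TangentSpace (𝓡 4) x), g.leviCivita (fun y : M ↦ J y (Y y)) x v = J x (g.leviCivita Y x v))) → (∃ (S : Type)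
      (_ : TopologicalSpace S) (_ : T2Space S) (_ : SecondCountableTopology S) (_ : ChartedSpace (EuclideanSpace ℝ
      (Fin 4)) S) (_ : IsManifold (𝓡 4) ∞ S) (_ : CompactSpace S), Nonempty (ContinuousMap.HomotopyEquiv S
      (Metric.sphere (0 : EuclideanSpace ℝ (Fin 5)) 1)) ∧ ∀ t : ℝ, ∃ (Φ : M → S) (Ψ : S → M), ContMDiffOn (𝓡 4) (𝓡
      4) ∞ Φ {x : M | f x < t} ∧ IsOpen (Φ '' {x : M | f x < t}) ∧ ContMDiffOn (𝓡 4) (𝓡 4) ∞ Ψ (Φ '' {x : M | f x <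
      t}) ∧ ∀ x ∈ {x : M | f x < t}, Ψ (Φ x) = x) → ∫⁻ x, ENNReal.ofReal (Real.exp (-f x))
      ∂(Literature.Geometry.Lorentzian.riemannianMeasure (g.toContMDiffRiemannianMetric hg)) ≤ ENNReal.ofReal (32 *
      Real.pi ^ 2 * Real.sqrt Real.pi * Real.exp (-(3 : ℝ) / 2))) →
    (∀ (M : Type) [TopologicalSpace M] [T2Space M] [SecondCountableTopology M] [ChartedSpace (EuclideanSpace ℝ (Fin
      4)) M] [IsManifold (𝓡 4) ∞ M] [ConnectedSpace M] [NoncompactSpace M] [T3Space M] [MeasurableSpace M]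
      [BorelSpace M] (g : Literature.Geometry.Lorentzian.PseudoRiemannianMetric (𝓡 4) ∞ (EuclideanSpace ℝ (Fin 4))
      (TangentSpace (𝓡 4) : M → Type _)) [g.HasLeviCivita] (f : M → ℝ) (hg : g.IsRiemannian), (∀ (x : M) (r :
      NNReal), IsCompact {y : M | g.edist hg x y ≤ r}) → ContMDiff (𝓡 4) 𝓘(ℝ, ℝ) ∞ f → (∀ (x : M) (X Y :
      TangentSpace (𝓡 4) x), g.ricci x X Y + g.hessian f x X Y = (1 / 2 : ℝ) * g.val x X Y) → (∀ x : M,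
      g.scalarCurvature x + g.gradSq f x = f x) → (∃ x : M, g.scalarCurvature x ≠ 0) → (∀ ε : ℝ, 0 < ε → ∃ K : Set
      M, IsCompact K ∧ ∀ x, x ∉ K → g.scalarCurvature x < ε) → ¬ (∃ J : (∀ x : M, TangentSpace (𝓡 4) x →L[ℝ]
      TangentSpace (𝓡 4) x), (∀ (x : M) (v : TangentSpace (𝓡 4) x), J x (J x v) = -v) ∧ (∀ (x : M) (v w :
      TangentSpace (𝓡 4) x), g.val x (J x v) (J x w) = g.val x v w) ∧ (∀ Y : (∀ x : M, TangentSpace (𝓡 4) x), (∀ x :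
      M, MDifferentiableAt (𝓡 4) ((𝓡 4).prod 𝓘(ℝ, EuclideanSpace ℝ (Fin 4))) (fun y : M ↦ Bundle.TotalSpace.mk'
      (EuclideanSpace ℝ (Fin 4)) y (Y y)) x) → (∀ x : M, MDifferentiableAt (𝓡 4) ((𝓡 4).prod 𝓘(ℝ, EuclideanSpace ℝ
      (Fin 4))) (fun y : M ↦ Bundle.TotalSpace.mk' (EuclideanSpace ℝ (Fin 4)) y (J y (Y y))) x) ∧ ∀ (x : M) (v :
      TangentSpace (𝓡 4) x), g.leviCivita (fun y : M ↦ J y (Y y)) x v = J x (g.leviCivita Y x v))) → ¬ (∃ (S : Type)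
      (_ : TopologicalSpace S) (_ : T2Space S) (_ : SecondCountableTopology S) (_ : ChartedSpace (EuclideanSpace ℝ
      (Fin 4)) S) (_ : IsManifold (𝓡 4) ∞ S) (_ : CompactSpace S), Nonempty (ContinuousMap.HomotopyEquiv S
      (Metric.sphere (0 : EuclideanSpace ℝ (Fin 5)) 1)) ∧ ∀ t : ℝ, ∃ (Φ : M → S) (Ψ : S → M), ContMDiffOn (𝓡 4) (𝓡
      4) ∞ Φ {x : M | f x < t} ∧ IsOpen (Φ '' {x : M | f x < t}) ∧ ContMDiffOn (𝓡 4) (𝓡 4) ∞ Ψ (Φ '' {x : M | f x <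
      t}) ∧ ∀ x ∈ {x : M | f x < t}, Ψ (Φ x) = x) → ∫⁻ x, ENNReal.ofReal (Real.exp (-f x))
      ∂(Literature.Geometry.Lorentzian.riemannianMeasure (g.toContMDiffRiemannianMetric hg)) ≤ ENNReal.ofReal (32 *
      Real.pi ^ 2 * Real.sqrt Real.pi * Real.exp (-(3 : ℝ) / 2))) →
    Summit.SmoothPoincare4.SmoothPoincare4.Theses.EntropyRung.ConicalGap := by
  intro hK hC hU M _ _ _ _ _ _ _ _ _ _ g _ f hg hc hf hsol hnorm hnf hdec
  by_cases hJ : (∃ J : (∀ x : M, TangentSpace (𝓡 4) x →L[ℝ] TangentSpace (𝓡 4) x), (∀ (x : M) (v : TangentSpace (𝓡 4) x), J x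
    (J x v) = -v) ∧ (∀ (x : M) (v w : TangentSpace (𝓡 4) x), g.val x (J x v) (J x w) = g.val x v w) ∧ (∀ Y : (∀ x
    : M, TangentSpace (𝓡 4) x), (∀ x : M, MDifferentiableAt (𝓡 4) ((𝓡 4).prod 𝓘(ℝ, EuclideanSpace ℝ (Fin 4))) (fun
    y : M ↦ Bundle.TotalSpace.mk' (EuclideanSpace ℝ (Fin 4)) y (Y y)) x) → (∀ x : M, MDifferentiableAt (𝓡 4) ((𝓡
    4).prod 𝓘(ℝ, EuclideanSpace ℝ (Fin 4))) (fun y : M ↦ Bundle.TotalSpace.mk' (EuclideanSpace ℝ (Fin 4)) y (J y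
    (Y y))) x) ∧ ∀ (x : M) (v : TangentSpace (𝓡 4) x), g.leviCivita (fun y : M ↦ J y (Y y)) x v = J x
    (g.leviCivita Y x v)))
  · exact hK M g f hg hc hf hsol hnorm hnf hdec hJ
  · by_cases hS : (∃ (S : Type) (_ : TopologicalSpace S) (_ : T2Space S) (_ : SecondCountableTopology S) (_ : ChartedSpace
      (EuclideanSpace ℝ (Fin 4)) S) (_ : IsManifold (𝓡 4) ∞ S) (_ : CompactSpace S), Nonempty
      (ContinuousMap.HomotopyEquiv S (Metric.sphere (0 : EuclideanSpace ℝ (Fin 5)) 1)) ∧ ∀ t : ℝ, ∃ (Φ : M → S) (Ψ :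
      S → M), ContMDiffOn (𝓡 4) (𝓡 4) ∞ Φ {x : M | f x < t} ∧ IsOpen (Φ '' {x : M | f x < t}) ∧ ContMDiffOn (𝓡 4) (𝓡
      4) ∞ Ψ (Φ '' {x : M | f x < t}) ∧ ∀ x ∈ {x : M | f x < t}, Ψ (Φ x) = x)
    · exact hC M g f hg hc hf hsol hnorm hnf hdec hJ hS
    · exact hU M g f hg hc hf hsol hnorm hnf hdec hJ hS

/-- Sanity (K is a genuine WEAKENING of the crux): the Kähler child follows from the crux by forgetting `J`. [folklore] -/
theorem kaehlerConicalGap_of_conicalGap (h : Summit.SmoothPoincare4.SmoothPoincare4.Theses.EntropyRung.ConicalGap) :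
    ∀ (M : Type) [TopologicalSpace M] [T2Space M] [SecondCountableTopology M] [ChartedSpace (EuclideanSpace ℝ (Fin
      4)) M] [IsManifold (𝓡 4) ∞ M] [ConnectedSpace M] [NoncompactSpace M] [T3Space M] [MeasurableSpace M]
      [BorelSpace M] (g : Literature.Geometry.Lorentzian.PseudoRiemannianMetric (𝓡 4) ∞ (EuclideanSpace ℝ (Fin 4))
      (TangentSpace (𝓡 4) : M → Type _)) [g.HasLeviCivita] (f : M → ℝ) (hg : g.IsRiemannian), (∀ (x : M) (r :
      NNReal), IsCompact {y : M | g.edist hg x y ≤ r}) → ContMDiff (𝓡 4) 𝓘(ℝ, ℝ) ∞ f → (∀ (x : M) (X Y :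
      TangentSpace (𝓡 4) x), g.ricci x X Y + g.hessian f x X Y = (1 / 2 : ℝ) * g.val x X Y) → (∀ x : M,
      g.scalarCurvature x + g.gradSq f x = f x) → (∃ x : M, g.scalarCurvature x ≠ 0) → (∀ ε : ℝ, 0 < ε → ∃ K : Set
      M, IsCompact K ∧ ∀ x, x ∉ K → g.scalarCurvature x < ε) → (∃ J : (∀ x : M, TangentSpace (𝓡 4) x →L[ℝ]
      TangentSpace (𝓡 4) x), (∀ (x : M) (v : TangentSpace (𝓡 4) x), J x (J x v) = -v) ∧ (∀ (x : M) (v w :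
      TangentSpace (𝓡 4) x), g.val x (J x v) (J x w) = g.val x v w) ∧ (∀ Y : (∀ x : M, TangentSpace (𝓡 4) x), (∀ x :
      M, MDifferentiableAt (𝓡 4) ((𝓡 4).prod 𝓘(ℝ, EuclideanSpace ℝ (Fin 4))) (fun y : M ↦ Bundle.TotalSpace.mk'
      (EuclideanSpace ℝ (Fin 4)) y (Y y)) x) → (∀ x : M, MDifferentiableAt (𝓡 4) ((𝓡 4).prod 𝓘(ℝ, EuclideanSpace ℝ
      (Fin 4))) (fun y : M ↦ Bundle.TotalSpace.mk' (EuclideanSpace ℝ (Fin 4)) y (J y (Y y))) x) ∧ ∀ (x : M) (v :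
      TangentSpace (𝓡 4) x), g.leviCivita (fun y : M ↦ J y (Y y)) x v = J x (g.leviCivita Y x v))) → ∫⁻ x,
      ENNReal.ofReal (Real.exp (-f x)) ∂(Literature.Geometry.Lorentzian.riemannianMeasure
      (g.toContMDiffRiemannianMetric hg)) ≤ ENNReal.ofReal (32 * Real.pi ^ 2 * Real.sqrt Real.pi * Real.exp (-(3 :
      ℝ) / 2)) := by
  intro M _ _ _ _ _ _ _ _ _ _ g _ f hg hc hf hsol hnorm hnf hdec _
  exact h M g f hg hc hf hsol hnorm hnf hdec

/-- Sanity (C is a genuine weakening of the crux): the confined non-Kähler child follows from the crux. [folklore] -/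
theorem confinedNonKaehlerConicalGap_of_conicalGap
    (h : Summit.SmoothPoincare4.SmoothPoincare4.Theses.EntropyRung.ConicalGap) :
    ∀ (M : Type) [TopologicalSpace M] [T2Space M] [SecondCountableTopology M] [ChartedSpace (EuclideanSpace ℝ (Fin
      4)) M] [IsManifold (𝓡 4) ∞ M] [ConnectedSpace M] [NoncompactSpace M] [T3Space M] [MeasurableSpace M]
      [BorelSpace M] (g : Literature.Geometry.Lorentzian.PseudoRiemannianMetric (𝓡 4) ∞ (EuclideanSpace ℝ (Fin 4))
      (TangentSpace (𝓡 4) : M → Type _)) [g.HasLeviCivita] (f : M → ℝ) (hg : g.IsRiemannian), (∀ (x : M) (r :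
      NNReal), IsCompact {y : M | g.edist hg x y ≤ r}) → ContMDiff (𝓡 4) 𝓘(ℝ, ℝ) ∞ f → (∀ (x : M) (X Y :
      TangentSpace (𝓡 4) x), g.ricci x X Y + g.hessian f x X Y = (1 / 2 : ℝ) * g.val x X Y) → (∀ x : M,
      g.scalarCurvature x + g.gradSq f x = f x) → (∃ x : M, g.scalarCurvature x ≠ 0) → (∀ ε : ℝ, 0 < ε → ∃ K : Set
      M, IsCompact K ∧ ∀ x, x ∉ K → g.scalarCurvature x < ε) → ¬ (∃ J : (∀ x : M, TangentSpace (𝓡 4) x →L[ℝ]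
      TangentSpace (𝓡 4) x), (∀ (x : M) (v : TangentSpace (𝓡 4) x), J x (J x v) = -v) ∧ (∀ (x : M) (v w :
      TangentSpace (𝓡 4) x), g.val x (J x v) (J x w) = g.val x v w) ∧ (∀ Y : (∀ x : M, TangentSpace (𝓡 4) x), (∀ x :
      M, MDifferentiableAt (𝓡 4) ((𝓡 4).prod 𝓘(ℝ, EuclideanSpace ℝ (Fin 4))) (fun y : M ↦ Bundle.TotalSpace.mk'
      (EuclideanSpace ℝ (Fin 4)) y (Y y)) x) → (∀ x : M, MDifferentiableAt (𝓡 4) ((𝓡 4).prod 𝓘(ℝ, EuclideanSpace ℝ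
      (Fin 4))) (fun y : M ↦ Bundle.TotalSpace.mk' (EuclideanSpace ℝ (Fin 4)) y (J y (Y y))) x) ∧ ∀ (x : M) (v :
      TangentSpace (𝓡 4) x), g.leviCivita (fun y : M ↦ J y (Y y)) x v = J x (g.leviCivita Y x v))) → (∃ (S : Type)
      (_ : TopologicalSpace S) (_ : T2Space S) (_ : SecondCountableTopology S) (_ : ChartedSpace (EuclideanSpace ℝ
      (Fin 4)) S) (_ : IsManifold (𝓡 4) ∞ S) (_ : CompactSpace S), Nonempty (ContinuousMap.HomotopyEquiv S
      (Metric.sphere (0 : EuclideanSpace ℝ (Fin 5)) 1)) ∧ ∀ t : ℝ, ∃ (Φ : M → S) (Ψ : S → M), ContMDiffOn (𝓡 4) (𝓡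
      4) ∞ Φ {x : M | f x < t} ∧ IsOpen (Φ '' {x : M | f x < t}) ∧ ContMDiffOn (𝓡 4) (𝓡 4) ∞ Ψ (Φ '' {x : M | f x <
      t}) ∧ ∀ x ∈ {x : M | f x < t}, Ψ (Φ x) = x) → ∫⁻ x, ENNReal.ofReal (Real.exp (-f x))
      ∂(Literature.Geometry.Lorentzian.riemannianMeasure (g.toContMDiffRiemannianMetric hg)) ≤ ENNReal.ofReal (32 *
      Real.pi ^ 2 * Real.sqrt Real.pi * Real.exp (-(3 : ℝ) / 2)) := by
  intro M _ _ _ _ _ _ _ _ _ _ g _ f hg hc hf hsol hnorm hnf hdec _ _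
  exact h M g f hg hc hf hsol hnorm hnf hdec

/-- Sanity (U is a genuine weakening of the crux): the unconfined non-Kähler child follows from the crux. [folklore] -/
theorem unconfinedNonKaehlerConicalGap_of_conicalGap
    (h : Summit.SmoothPoincare4.SmoothPoincare4.Theses.EntropyRung.ConicalGap) :
    ∀ (M : Type) [TopologicalSpace M] [T2Space M] [SecondCountableTopology M] [ChartedSpace (EuclideanSpace ℝ (Fin
      4)) M] [IsManifold (𝓡 4) ∞ M] [ConnectedSpace M] [NoncompactSpace M] [T3Space M] [MeasurableSpace M]
      [BorelSpace M] (g : Literature.Geometry.Lorentzian.PseudoRiemannianMetric (𝓡 4) ∞ (EuclideanSpace ℝ (Fin 4))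
      (TangentSpace (𝓡 4) : M → Type _)) [g.HasLeviCivita] (f : M → ℝ) (hg : g.IsRiemannian), (∀ (x : M) (r :
      NNReal), IsCompact {y : M | g.edist hg x y ≤ r}) → ContMDiff (𝓡 4) 𝓘(ℝ, ℝ) ∞ f → (∀ (x : M) (X Y :
      TangentSpace (𝓡 4) x), g.ricci x X Y + g.hessian f x X Y = (1 / 2 : ℝ) * g.val x X Y) → (∀ x : M,
      g.scalarCurvature x + g.gradSq f x = f x) → (∃ x : M, g.scalarCurvature x ≠ 0) → (∀ ε : ℝ, 0 < ε → ∃ K : Set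
      M, IsCompact K ∧ ∀ x, x ∉ K → g.scalarCurvature x < ε) → ¬ (∃ J : (∀ x : M, TangentSpace (𝓡 4) x →L[ℝ]
      TangentSpace (𝓡 4) x), (∀ (x : M) (v : TangentSpace (𝓡 4) x), J x (J x v) = -v) ∧ (∀ (x : M) (v w :
      TangentSpace (𝓡 4) x), g.val x (J x v) (J x w) = g.val x v w) ∧ (∀ Y : (∀ x : M, TangentSpace (𝓡 4) x), (∀ x :
      M, MDifferentiableAt (𝓡 4) ((𝓡 4).prod 𝓘(ℝ, EuclideanSpace ℝ (Fin 4))) (fun y : M ↦ Bundle.TotalSpace.mk'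
      (EuclideanSpace ℝ (Fin 4)) y (Y y)) x) → (∀ x : M, MDifferentiableAt (𝓡 4) ((𝓡 4).prod 𝓘(ℝ, EuclideanSpace ℝ
      (Fin 4))) (fun y : M ↦ Bundle.TotalSpace.mk' (EuclideanSpace ℝ (Fin 4)) y (J y (Y y))) x) ∧ ∀ (x : M) (v :
      TangentSpace (𝓡 4) x), g.leviCivita (fun y : M ↦ J y (Y y)) x v = J x (g.leviCivita Y x v))) → ¬ (∃ (S : Type)
      (_ : TopologicalSpace S) (_ : T2Space S) (_ : SecondCountableTopology S) (_ : ChartedSpace (EuclideanSpace ℝ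
      (Fin 4)) S) (_ : IsManifold (𝓡 4) ∞ S) (_ : CompactSpace S), Nonempty (ContinuousMap.HomotopyEquiv S
      (Metric.sphere (0 : EuclideanSpace ℝ (Fin 5)) 1)) ∧ ∀ t : ℝ, ∃ (Φ : M → S) (Ψ : S → M), ContMDiffOn (𝓡 4) (𝓡
      4) ∞ Φ {x : M | f x < t} ∧ IsOpen (Φ '' {x : M | f x < t}) ∧ ContMDiffOn (𝓡 4) (𝓡 4) ∞ Ψ (Φ '' {x : M | f x <
      t}) ∧ ∀ x ∈ {x : M | f x < t}, Ψ (Φ x) = x) → ∫⁻ x, ENNReal.ofReal (Real.exp (-f x))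
      ∂(Literature.Geometry.Lorentzian.riemannianMeasure (g.toContMDiffRiemannianMetric hg)) ≤ ENNReal.ofReal (32 *
      Real.pi ^ 2 * Real.sqrt Real.pi * Real.exp (-(3 : ℝ) / 2)) := by
  intro M _ _ _ _ _ _ _ _ _ _ g _ f hg hc hf hsol hnorm hnf hdec _ _
  exact h M g f hg hc hf hsol hnorm hnf hdec

/-- The three children together are EQUIVALENT to the crux (partition of the class): the split loses and adds nothing.
[folklore] -/
theorem conicalGap_iff_subs :
    Summit.SmoothPoincare4.SmoothPoincare4.Theses.EntropyRung.ConicalGap ↔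
    ((∀ (M : Type) [TopologicalSpace M] [T2Space M] [SecondCountableTopology M] [ChartedSpace (EuclideanSpace ℝ (Fin
        4)) M] [IsManifold (𝓡 4) ∞ M] [ConnectedSpace M] [NoncompactSpace M] [T3Space M] [MeasurableSpace M]
        [BorelSpace M] (g : Literature.Geometry.Lorentzian.PseudoRiemannianMetric (𝓡 4) ∞ (EuclideanSpace ℝ (Fin 4))
        (TangentSpace (𝓡 4) : M → Type _)) [g.HasLeviCivita] (f : M → ℝ) (hg : g.IsRiemannian), (∀ (x : M) (r :
        NNReal), IsCompact {y : M | g.edist hg x y ≤ r}) → ContMDiff (𝓡 4) 𝓘(ℝ, ℝ) ∞ f → (∀ (x : M) (X Y :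
        TangentSpace (𝓡 4) x), g.ricci x X Y + g.hessian f x X Y = (1 / 2 : ℝ) * g.val x X Y) → (∀ x : M,
        g.scalarCurvature x + g.gradSq f x = f x) → (∃ x : M, g.scalarCurvature x ≠ 0) → (∀ ε : ℝ, 0 < ε → ∃ K : Set
        M, IsCompact K ∧ ∀ x, x ∉ K → g.scalarCurvature x < ε) → (∃ J : (∀ x : M, TangentSpace (𝓡 4) x →L[ℝ]
        TangentSpace (𝓡 4) x), (∀ (x : M) (v : TangentSpace (𝓡 4) x), J x (J x v) = -v) ∧ (∀ (x : M) (v w :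
        TangentSpace (𝓡 4) x), g.val x (J x v) (J x w) = g.val x v w) ∧ (∀ Y : (∀ x : M, TangentSpace (𝓡 4) x), (∀ x :
        M, MDifferentiableAt (𝓡 4) ((𝓡 4).prod 𝓘(ℝ, EuclideanSpace ℝ (Fin 4))) (fun y : M ↦ Bundle.TotalSpace.mk'
        (EuclideanSpace ℝ (Fin 4)) y (Y y)) x) → (∀ x : M, MDifferentiableAt (𝓡 4) ((𝓡 4).prod 𝓘(ℝ, EuclideanSpace ℝ
        (Fin 4))) (fun y : M ↦ Bundle.TotalSpace.mk' (EuclideanSpace ℝ (Fin 4)) y (J y (Y y))) x) ∧ ∀ (x : M) (v :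
        TangentSpace (𝓡 4) x), g.leviCivita (fun y : M ↦ J y (Y y)) x v = J x (g.leviCivita Y x v))) → ∫⁻ x,
        ENNReal.ofReal (Real.exp (-f x)) ∂(Literature.Geometry.Lorentzian.riemannianMeasure
        (g.toContMDiffRiemannianMetric hg)) ≤ ENNReal.ofReal (32 * Real.pi ^ 2 * Real.sqrt Real.pi * Real.exp (-(3 :
        ℝ) / 2))) ∧
      (∀ (M : Type) [TopologicalSpace M] [T2Space M] [SecondCountableTopology M] [ChartedSpace (EuclideanSpace ℝ (Fin
        4)) M] [IsManifold (𝓡 4) ∞ M] [ConnectedSpace M] [NoncompactSpace M] [T3Space M] [MeasurableSpace M]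
        [BorelSpace M] (g : Literature.Geometry.Lorentzian.PseudoRiemannianMetric (𝓡 4) ∞ (EuclideanSpace ℝ (Fin 4))
        (TangentSpace (𝓡 4) : M → Type _)) [g.HasLeviCivita] (f : M → ℝ) (hg : g.IsRiemannian), (∀ (x : M) (r :
        NNReal), IsCompact {y : M | g.edist hg x y ≤ r}) → ContMDiff (𝓡 4) 𝓘(ℝ, ℝ) ∞ f → (∀ (x : M) (X Y :
        TangentSpace (𝓡 4) x), g.ricci x X Y + g.hessian f x X Y = (1 / 2 : ℝ) * g.val x X Y) → (∀ x : M,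
        g.scalarCurvature x + g.gradSq f x = f x) → (∃ x : M, g.scalarCurvature x ≠ 0) → (∀ ε : ℝ, 0 < ε → ∃ K : Set
        M, IsCompact K ∧ ∀ x, x ∉ K → g.scalarCurvature x < ε) → ¬ (∃ J : (∀ x : M, TangentSpace (𝓡 4) x →L[ℝ]
        TangentSpace (𝓡 4) x), (∀ (x : M) (v : TangentSpace (𝓡 4) x), J x (J x v) = -v) ∧ (∀ (x : M) (v w :
        TangentSpace (𝓡 4) x), g.val x (J x v) (J x w) = g.val x v w) ∧ (∀ Y : (∀ x : M, TangentSpace (𝓡 4) x), (∀ x :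
        M, MDifferentiableAt (𝓡 4) ((𝓡 4).prod 𝓘(ℝ, EuclideanSpace ℝ (Fin 4))) (fun y : M ↦ Bundle.TotalSpace.mk'
        (EuclideanSpace ℝ (Fin 4)) y (Y y)) x) → (∀ x : M, MDifferentiableAt (𝓡 4) ((𝓡 4).prod 𝓘(ℝ, EuclideanSpace ℝ
        (Fin 4))) (fun y : M ↦ Bundle.TotalSpace.mk' (EuclideanSpace ℝ (Fin 4)) y (J y (Y y))) x) ∧ ∀ (x : M) (v :
        TangentSpace (𝓡 4) x), g.leviCivita (fun y : M ↦ J y (Y y)) x v = J x (g.leviCivita Y x v))) → (∃ (S : Type)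
        (_ : TopologicalSpace S) (_ : T2Space S) (_ : SecondCountableTopology S) (_ : ChartedSpace (EuclideanSpace ℝ
        (Fin 4)) S) (_ : IsManifold (𝓡 4) ∞ S) (_ : CompactSpace S), Nonempty (ContinuousMap.HomotopyEquiv S
        (Metric.sphere (0 : EuclideanSpace ℝ (Fin 5)) 1)) ∧ ∀ t : ℝ, ∃ (Φ : M → S) (Ψ : S → M), ContMDiffOn (𝓡 4) (𝓡
        4) ∞ Φ {x : M | f x < t} ∧ IsOpen (Φ '' {x : M | f x < t}) ∧ ContMDiffOn (𝓡 4) (𝓡 4) ∞ Ψ (Φ '' {x : M | f x <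
        t}) ∧ ∀ x ∈ {x : M | f x < t}, Ψ (Φ x) = x) → ∫⁻ x, ENNReal.ofReal (Real.exp (-f x))
        ∂(Literature.Geometry.Lorentzian.riemannianMeasure (g.toContMDiffRiemannianMetric hg)) ≤ ENNReal.ofReal (32 *
        Real.pi ^ 2 * Real.sqrt Real.pi * Real.exp (-(3 : ℝ) / 2))) ∧
      (∀ (M : Type) [TopologicalSpace M] [T2Space M] [SecondCountableTopology M] [ChartedSpace (EuclideanSpace ℝ (Fin
        4)) M] [IsManifold (𝓡 4) ∞ M] [ConnectedSpace M] [NoncompactSpace M] [T3Space M] [MeasurableSpace M]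
        [BorelSpace M] (g : Literature.Geometry.Lorentzian.PseudoRiemannianMetric (𝓡 4) ∞ (EuclideanSpace ℝ (Fin 4))
        (TangentSpace (𝓡 4) : M → Type _)) [g.HasLeviCivita] (f : M → ℝ) (hg : g.IsRiemannian), (∀ (x : M) (r :
        NNReal), IsCompact {y : M | g.edist hg x y ≤ r}) → ContMDiff (𝓡 4) 𝓘(ℝ, ℝ) ∞ f → (∀ (x : M) (X Y :
        TangentSpace (𝓡 4) x), g.ricci x X Y + g.hessian f x X Y = (1 / 2 : ℝ) * g.val x X Y) → (∀ x : M,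
        g.scalarCurvature x + g.gradSq f x = f x) → (∃ x : M, g.scalarCurvature x ≠ 0) → (∀ ε : ℝ, 0 < ε → ∃ K : Set
        M, IsCompact K ∧ ∀ x, x ∉ K → g.scalarCurvature x < ε) → ¬ (∃ J : (∀ x : M, TangentSpace (𝓡 4) x →L[ℝ]
        TangentSpace (𝓡 4) x), (∀ (x : M) (v : TangentSpace (𝓡 4) x), J x (J x v) = -v) ∧ (∀ (x : M) (v w :
        TangentSpace (𝓡 4) x), g.val x (J x v) (J x w) = g.val x v w) ∧ (∀ Y : (∀ x : M, TangentSpace (𝓡 4) x), (∀ x :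
        M, MDifferentiableAt (𝓡 4) ((𝓡 4).prod 𝓘(ℝ, EuclideanSpace ℝ (Fin 4))) (fun y : M ↦ Bundle.TotalSpace.mk'
        (EuclideanSpace ℝ (Fin 4)) y (Y y)) x) → (∀ x : M, MDifferentiableAt (𝓡 4) ((𝓡 4).prod 𝓘(ℝ, EuclideanSpace ℝ
        (Fin 4))) (fun y : M ↦ Bundle.TotalSpace.mk' (EuclideanSpace ℝ (Fin 4)) y (J y (Y y))) x) ∧ ∀ (x : M) (v :
        TangentSpace (𝓡 4) x), g.leviCivita (fun y : M ↦ J y (Y y)) x v = J x (g.leviCivita Y x v))) → ¬ (∃ (S : Type)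
        (_ : TopologicalSpace S) (_ : T2Space S) (_ : SecondCountableTopology S) (_ : ChartedSpace (EuclideanSpace ℝ
        (Fin 4)) S) (_ : IsManifold (𝓡 4) ∞ S) (_ : CompactSpace S), Nonempty (ContinuousMap.HomotopyEquiv S
        (Metric.sphere (0 : EuclideanSpace ℝ (Fin 5)) 1)) ∧ ∀ t : ℝ, ∃ (Φ : M → S) (Ψ : S → M), ContMDiffOn (𝓡 4) (𝓡
        4) ∞ Φ {x : M | f x < t} ∧ IsOpen (Φ '' {x : M | f x < t}) ∧ ContMDiffOn (𝓡 4) (𝓡 4) ∞ Ψ (Φ '' {x : M | f x <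
        t}) ∧ ∀ x ∈ {x : M | f x < t}, Ψ (Φ x) = x) → ∫⁻ x, ENNReal.ofReal (Real.exp (-f x))
        ∂(Literature.Geometry.Lorentzian.riemannianMeasure (g.toContMDiffRiemannianMetric hg)) ≤ ENNReal.ofReal (32 *
        Real.pi ^ 2 * Real.sqrt Real.pi * Real.exp (-(3 : ℝ) / 2)))) :=
  ⟨fun h ↦ ⟨kaehlerConicalGap_of_conicalGap h, confinedNonKaehlerConicalGap_of_conicalGap h,
    unconfinedNonKaehlerConicalGap_of_conicalGap h⟩, fun h ↦ conicalGap_of_subs h.1 h.2.1 h.2.2⟩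

end Summit.SmoothPoincare4.SmoothPoincare4.Theorems

end
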